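import Literature.NumberTheory.EllipticCurves.ShimuraCurveHeegnerSystemPrimitivesSplit
import Literature.NumberTheory.EllipticCurves.RingClassGenusCharacter
import HarnessLib

/-!
# The Heegner system of the Shimura curve `X_{N⁺,N⁻}` at the conductors `3m` for a `3`-GOOD curve with `E[3]`
# irreducible and `3` SPLIT in `K`: the CM points of conductor `3m` with their printed relations (norm, congruence,
# reflection pinned on `K[3]`) and the Cai–Shu–Tian display of the GENUS component of conductor `3` — ONE named fact

Named literature fact (ONE `def … : Prop`, D-0014; no theorem, no `sorry`, no instance, no notation), the
conductor-`3m` companion of `Literature.NumberTheory.EllipticCurves.shimuraCurve_heegnerSystem_primitivesSplitReduced`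
(file `ShimuraCurveHeegnerSystemPrimitivesSplit.lean`: the SAME Shimura curve, the SAME binders at `p = 3` with the one
extra guard `3 ∤ N`, the CM-point family at conductors `m`). Filed for the cell `bsd-wall`, route `RamifiedHeegnerPair`,
cruxes U₁ `LeafRankOneUpperAtThree` (stmt-BirchSwinnertonDyer-26022) ∕ U₀ (26024), line `partnerdescent`: its
registered stub (DISPLAY-L) `stub_partnerGenusDisplayLabelledAtThree` asks, for a leaf curve `E` (additive at `3`,
Kodaira `I₀*`) and its `3`-good twist partner `V ≅ E^{(−3)}`, a LABELLED `E`-family over the ring class tower of `K`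
with the real Gross–Zagier display; the lead's port plan (`Cruxes/LeafRankOneUpperAtThree/LEAD-G57-DISPLAYL-PORT.md`)
reduces it to kernel theorems already landed (genus transport `ψ_θ : V(L) ≃ W(L)`, its sign rule, Galois descent,
heights, the period ledger) PLUS exactly one printed input on the `V`-side, which is THIS text: the CM points of
conductor `3m` of `V`'s Jacquet–Langlands parametrisation `X_{N⁺,N⁻} → V′` with Gross's ∕ Nekovář's relations between
conductors `3m` and `3m/ℓ`, and the explicit Gross–Zagier formula for the ring class character `χ = χ₋₃ ∘ Nm` of
conductor `c = 3` (the genus character cutting out `K[m](√−3) = K[3m]` inside `K[3m]`). Nothing on the `E`-side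
(no twist, no descent) is asserted here — that is the consumer's kernel work.

## Sources (clause by clause)

* Existence and field of definition of the CM points of conductor `c` (ANY `c` prime to `N`) on the indefinite
  Shimura curve `X_{N⁺,N⁻}`, rational over the ring class field `K[c]`: Bertolini–Darmon, Invent. Math. 126 (1996)
  [BertoliniDarmon1996] §2.1–2.5 (p. 432 «the points in `H_N(K; c)` … are actually defined over the field `K₀` …
  Shimura reciprocity law»); Nekovář, LMS LN 320 (2007) [Nekovar2007] §§2–4 (CM points `x(𝔫)` of conductor
  `c(x)𝔫` on `N_H^*`, `K(x(𝔫)) ⊂ K[c(x)𝔫]`, (4.1)–(4.5) p. 566–567), here with `c(x) = 3`.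
* (B1χ) the display for the genus component of conductor `3`:
  `degy · [K[3]:K] · L′(V/K, χ, 1) = (8π²(φ,φ)_{Γ₀(N)} / (u² √|d_K c²|)) · ĥ_{K[3]}(P_χ)`, `u = 1`, `c = 3`,
  `P_χ = Σ_{σ ∈ Gal(K[3]/K)} χ(σ) σ·y(3)`: Cai–Shu–Tian [CaiShuTian2014] Thm. 1.5 with special case 1 (arXiv:1408.1733
  p. 6 l. 32 – p. 7 l. 16: `F = ℚ`, `A = E`, `χ` a character of `Pic(𝒪_c)`, `(N, Dc) = 1`, `u = #κ_c·[𝒪_c^× : 𝒪^×] = 1`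
  for `c = 3` and `d_K ∉ {−3, −4}`, `(f,f)_U = deg f`, `P⁰_χ(f) = Σ_{t ∈ Pic(𝒪_c)} f(P)^{σ_t} χ(t)`, `ĥ_K` the
  Néron–Tate height over `K` on `E(K^{ab})`, i.e. `ĥ_{K[3]}/[K[3]:K]` in the tree's field-proportional normalisation
  `canonicalHeight_baseChange`); `L(V/K, χ₋₃∘Nm, s) = L(V^{(−3)}, s)·L(V^{(−3 d_K)}, s)` (Artin formalism for the
  induced representation `Ind_K^ℚ(χ₋₃∘Nm) = χ₋₃ ⊕ χ₋₃χ_{d_K}`; Coates–Li–Tian–Zhai, Proc. LMS 110 (2015)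
  [CoatesLiTianZhai2015] Thm. 2.5 ∕ Lemma 2.7 for the genus points `y_R = Σ χ_R(σ) f(P_R)^σ`), written with the tree's
  `LDerivEK (W.quadraticTwist (-3)) K` (`= (L(W^{(−3)})·L(W^{(−3d_K)}))′(1)`, `quadraticTwist_quadraticTwist`); the degree
  bookkeeping `degy ≥ 1`, `ord₃ degy = ord₃ deg P₀` (normalised morphism through a quotient of `J(X_{N⁺,N⁻})` of degree
  prime to `3`, which exists because `E[3]` is irreducible): Jetchev–Skinner–Wan [JetchevSkinnerWan2017] §4.3, Remarks
  17–18; Pasten [PastenShimura2024] Prop. 5.1 — VERBATIM the sibling's (B1) bookkeeping.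
* `ε = 1 ∨ ε = −1`, (B3χ) reflection PINNED on `K[3]`: for every `m ≠ 0` and every complex conjugation `τ` of `K[3m]`
  there is `σ′ ∈ Gal(K[3m]/K)` with `τ y(3m) − ε σ′ y(3m)` torsion, all the `σ′` restricting to ONE `σ₃ ∈ Gal(K[3]/K)`:
  Gross, LMS LN 153 (1991) [GrossLMS1991] (5.1)–(5.2) and Prop. 5.3 (p. 240) «`y_n^τ = ε·y_n^{σ′} + (torsion)`»,
  `σ′ = σ_{[𝔫 ∩ 𝒪_n]}^{±1}` read off the proof (compatible along the tower by Cox Prop. 7.20, §9.A); on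
  `X_{N⁺,N⁻}`: [BertoliniDarmon1996] Prop. 2.6 (p. 433) «`τ(P_n) = σ W′(P_n)`»; the pinned shape is that of the tree's
  `GrossLMS1991.prop53_conj_pinned_birch` (`HeegnerPointsOfConductorConjugationBirch.lean`), pinned one level up.
* (B4′) norm relation between conductors `3m` and `3m/ℓ` at a prime `ℓ ∣ m` (`m` square-free, prime factors inert
  in `K` and prime to `N`; `σ` a generator of `Gal(K[3m]/K[3m/ℓ])`, cyclic of order `ℓ + 1` since `𝒪_K^× = {±1}`):
  `Σ_{i=0}^{ℓ} σ^i y(3m) = a_ℓ · y(3m/ℓ)↑`: [GrossLMS1991] Prop. 3.7 (1) (p. 237); [Nekovar2007] (4.8) Proposition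
  (p. 570, the norm relation for `x(𝔫ℓ)` over `x(𝔫)` at ANY conductor `c(x)𝔫`, `u(r) = 1`); [BertoliniDarmon1996] §2.4.
* (B5′) congruence above `ℓ` (`ℓ ∤ Δ_min`): the reduction of `γ · y(3m)` at a place over `ℓ` is the `ℓ`-power
  Frobenius of the reduction of `γ · y(3m/ℓ)↑`, every `γ ∈ Gal(K[3m]/K)`, every `K`-embedding of `K[3m]` into `K̄`:
  [GrossLMS1991] Prop. 3.7 (2); [Nekovar2007] (4.9) Proposition (p. 571 l. 9–15, «`x(𝔫ℓ) ≡ Fr(ℓ) x(𝔫) (mod λ)`»,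
  ANY conductor) and (4.13) (ii).

## Rendering and quantifier shape

Binders = those of `shimuraCurve_heegnerSystem_primitivesSplitReduced` at `p = 3` (curve `W` globally minimal of
conductor `N`, `W[3]` irreducible, `K` imaginary quadratic, an even set `S` of primes `ℓ ∥ N` inert-unramified in `K`
— `N⁻ = ∏S` —, every other prime of `N` split, `3` split, `X : ShimuraCurveData (∏S) (N/∏S)`, `P₀` class-minimal,
`Dt` a classical datum carrying the newform `φ = Dt.f`) PLUS `¬ 3 ∣ N` (the curve is `3`-GOOD: Cai–Shu–Tian's
`(c, N) = 1`). CONCLUSION: `∃ ι y ε degy` — an embedding `ι : K →+* ℂ` (fixing the tower `K[n] ⊂ ℂ`), a family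
`y : (n : ℕ) → W(K[n])` indexed by the CONDUCTOR (only the values `y(3m)` are constrained), the sign and the degree —
with `degy ≥ 1`, `ord₃ degy = ord₃ deg P₀`, (B1χ) ∧ `ε = ±1` ∧ (B3χ) ∧ (B4′) ∧ (B5′). (B1χ) is stated for EVERY
`θ ∈ K[3]` with `θ² = −3` (both signs give the same character `σ ↦ σθ/θ`, the tree's `genusSign θ σ`; that such `θ`
exists — `√−3 ∈ K[3]`, genus theory — is a tree THEOREM, `sqrt_intCast_mem_ringClassField`, and is NOT asserted here; the
height `ĥ_{K[3]}` = the tree's `canonicalHeight` on `W ⊗ K[3]` needs `K[3]` read as a number field, a binder `[NumberField K[3]]` the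
consumer discharges by the tree theorem `JET.numberField_ringClassField`)
and for every enumeration `T` of `Gal(K[3]/K)`; `[K[3]:K] = Module.finrank K K[3]`. (B4′) ∕ (B5′) are asked only at
square-free `m` whose prime factors `q` satisfy `q ∤ N` and `q𝒪_K` prime; (B3χ) at every `m ≠ 0`; values of `y` off
these conductors are immaterial (documented junk freedom, as in the siblings). On this locus `d_K ∉ {−3, −4}` (`3`
splits), so `[K[3mℓ] : K[3m]] = ℓ + 1` and `u = 1`.

## Standing ∕ what this fact does NOT say

HONEST: curve-level primitives printed for `X_{N⁺,N⁻}` at every conductor prime to `N` (Bertolini–Darmon §2,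
Nekovář §4); `E`-level forms printed verbatim for `X₀(N)` (Gross §§3–5) and transported through the Hecke-equivariant
parametrisation; the display is Cai–Shu–Tian's theorem for one test vector and one ring class character. NOTHING here
is about `Ш`, an index, a rank, a Selmer group, a twist or a descent. The tree has no CM points on `X_{N⁺,N⁻}`
(`ShimuraParametrizationData` is complex-analytic), so DISCHARGING this fact = Shimura reciprocity on `X_{N⁺,N⁻}` +
Eichler–Shimura + Cai–Shu–Tian: size XL; no `_holds` is attempted; consumers are CONDITIONAL on this name. It does not
imply and is not implied by the conductor-`m` sibling (different conductors, different character).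
Searched before filing (`lean search 'heegnerSystem_primitives|genusThree|conductor.*3m'`): the siblings at
conductor `m` (`…primitivesAtThree`, `…primitivesSplitReduced`, `…primitivesGuarded`), the `X₀(N)` genus-character
transport of cell bsd-addord (`GenusKolyvagin.*`, unramified genus characters `d₁ ∣ d_K`, conductor `m`), Hu–Shu–Yin's
conductor-`9pn` points on `X₀(243)`; no family at conductors `3m` on `X_{N⁺,N⁻}` and no Gross–Zagier display for a
RAMIFIED ring class character; nothing is restated.
presearch: «CM points of conductor 3m on Shimura curves, norm relations, genus character Gross–Zagier» →
[corpus:paper:arxiv-1408.1733 pp. 6–7] Thm. 1.5 ∕ special case 1 (display, `u`, `c`); [corpus: Nekovář 2007 (4.8)–(4.9),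
book:burns2007-l-functions-galois-representations p0570–p0571]; [corpus:paper:arxiv-1312.3884 Thm. 2.5, Lemma 2.7]
(genus points `y_R`, `L(E/K,χ_R) = L(E^{(d₁)})L(E^{(d₂)})`); galaxy «ring class character|conductor 3|genus point» →
the same CLTZ ∕ CST pages.
-/

noncomputable section

open scoped Classical

namespace Literature.NumberTheory.EllipticCurves

open _root_.WeierstrassCurve Field NumberField CongruenceSubgroup Literature.NumberTheory.Automorphic
  Literature.NumberTheory.EllipticCurves.ModularForms

section Fact

/-- **The Heegner system of `X_{N⁺,N⁻}` at the conductors `3m` for a `3`-good curve with `E[3]` irreducible and `3`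
split in `K`, with its printed relations and the Cai–Shu–Tian display of the genus component of conductor `3`.**
Binders = `shimuraCurve_heegnerSystem_primitivesSplitReduced`'s at `p = 3` plus `3 ∤ N`. THERE ARE `ι : K → ℂ`,
points `y(n) ∈ E(K[n])`, `ε = ±1`, `degy ≥ 1` with `ord₃ degy = ord₃ P₀.deg` and
(B1χ) for every `θ ∈ K[3]`, `θ² = −3`, and `P_χ := Σ_{σ ∈ Gal(K[3]/K)} χ(σ)·σ y(3)`, `χ(σ) = σθ/θ`:
`degy · [K[3]:K] · L′(E/K, χ, 1) = (8π²(φ,φ)_{Γ₀(N)}/(3√|d_K|)) · ĥ_{K[3]}(P_χ)`, `L(E/K,χ,s) = L(E^{(−3)},s)L(E^{(−3d_K)},s)`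
(Cai–Shu–Tian 2014 Thm. 1.5 sc 1 with `c = 3`, `u = 1`; JSW 2017 Rem. 17–18; Pasten Prop. 5.1);
(B3χ) ONE `σ₃ ∈ Gal(K[3]/K)` such that for every `m ≠ 0` and every complex conjugation `τ` of `K[3m]` some
`σ′ ∈ Gal(K[3m]/K)` restricting to `σ₃` has `τ y(3m) − ε σ′ y(3m)` torsion (Gross Prop. 5.3 with (5.1)–(5.2);
Bertolini–Darmon Prop. 2.6); (B4′) `Σ_{i=0}^{ℓ} σ^i y(3m) = a_ℓ · y(3m/ℓ)↑` for `σ` generating `Gal(K[3m]/K[3m/ℓ])`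
(Gross Prop. 3.7 (1); Nekovář (4.8)); (B5′) reduction above `ℓ` of `γ y(3m)` = `ℓ`-Frobenius of that of `γ y(3m/ℓ)↑`
(Gross Prop. 3.7 (2); Nekovář (4.9)) — (B4′)/(B5′) for square-free `m` with prime factors inert and prime to `N`.
-- TODO(general form): Nekovář 2007 §4 ∕ Cai–Shu–Tian Thm. 1.5 for every conductor `c` prime to `N d_K` and every
-- ring class character of conductor `c` (here `c = 3`, `χ` quadratic).
[cite: CaiShuTian2014, Thm. 1.5 and special case 1 (arXiv:1408.1733 pp. 6–7)]
[cite: Nekovar2007, (4.5) (p. 567), (4.8) (p. 570), (4.9) (p. 571), (4.13) (ii) (p. 573)]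
[cite: GrossLMS1991, §3 Prop. 3.7 (1)(2) (p. 237), §5 (5.1)–(5.2) and Prop. 5.3 (p. 240)]
[cite: BertoliniDarmon1996, §2.3–2.5 (pp. 432–433), Prop. 2.6 (p. 433)]
[cite: CoatesLiTianZhai2015, Thm. 2.5, Lemma 2.7]
[cite: JetchevSkinnerWan2017, §4.3 and Remarks 17–18 (pp. 18–19)]
[cite: PastenShimura2024, Prop. 5.1] -/
def shimuraCurve_heegnerSystem_genusThree : Prop :=
  ∀ (W : WeierstrassCurve ℚ) [W.IsElliptic] [W.IsGloballyMinimal]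
    (N : ℕ) [NeZero N] (K : Type) [Field K] [NumberField K] (S : Finset ℕ)
    (Dt : ModularParametrizationData W N)
    (X : ShimuraCurveData (∏ q ∈ S, q) (N / ∏ q ∈ S, q))
    (W' : WeierstrassCurve ℚ) [W'.IsElliptic] (P₀ : ShimuraParametrizationData X W'),
    W.conductorNorm ℤ = N → ¬ 3 ∣ N → W.HasIrreducibleModPGaloisRep 3 →
    IsImaginaryQuadratic K → Even S.card →
    (∀ ℓ ∈ S, ℓ.Prime ∧ ℓ ∣ N ∧ ¬ ℓ ^ 2 ∣ N ∧
      ((Ideal.span {(ℓ : ℤ)}).primesOver (𝓞 K)).ncard = 1 ∧ ¬ (ℓ : ℤ) ∣ NumberField.discr K) →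
    (∀ ℓ : ℕ, ℓ.Prime → ℓ ∣ N → ℓ ∉ S → ((Ideal.span {(ℓ : ℤ)}).primesOver (𝓞 K)).ncard = 2) →
    ((Ideal.span {(3 : ℤ)}).primesOver (𝓞 K)).ncard = 2 →
    P₀.IsMinimalFor W →
    ∃ (ι : K →+* ℂ) (y : (n : ℕ) → (W.baseChange (ringClassField K ι n)).toAffine.Point)
      (ε : ℤ) (degy : ℕ), 0 < degy ∧
      padicValNat 3 degy = padicValNat 3 P₀.deg ∧
      (∀ [NumberField (ringClassField K ι 3)] (θ : ringClassField K ι 3), θ ^ 2 = algebraMap ℚ (ringClassField K ι 3) (-3) →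
        ∀ T : Finset (ringClassField K ι 3 ≃ₐ[ℚ] ringClassField K ι 3),
        (∀ g, g ∈ T ↔ g ∈ ringClassGal ι 3) →
        (degy : ℂ) * (Module.finrank K (ringClassField K ι 3) : ℂ) * LDerivEK (W.quadraticTwist (-3)) K =
          8 * (Real.pi : ℂ) ^ 2 * peterssonProduct (Gamma0 N) 2 Dt.f Dt.f /
              ((3 * √|(NumberField.discr K : ℝ)| : ℝ) : ℂ) *
            ((∑ g ∈ T, ((genusSign θ g : ℤˣ) : ℤ) •
                pointGalHom W (ringClassField K ι 3) g (y 3)).canonicalHeight : ℂ)) ∧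
      (ε = 1 ∨ ε = -1) ∧
      (∃ σ₃ ∈ ringClassGal ι 3, ∀ (m : ℕ), m ≠ 0 →
        ∀ τm : ringClassField K ι (3 * m) ≃ₐ[ℚ] ringClassField K ι (3 * m),
        (∀ x : ringClassField K ι (3 * m), ((τm x : ringClassField K ι (3 * m)) : ℂ) = starRingEnd ℂ x) →
        ∃ σ' ∈ ringClassGal ι (3 * m),
          (∀ (x₃ : ringClassField K ι 3) (x : ringClassField K ι (3 * m)), (x : ℂ) = (x₃ : ℂ) →
            ((σ' x : ringClassField K ι (3 * m)) : ℂ) = ((σ₃ x₃ : ringClassField K ι 3) : ℂ)) ∧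
          IsOfFinAddOrder
            (pointGalHom W (ringClassField K ι (3 * m)) τm (y (3 * m)) -
              ε • pointGalHom W (ringClassField K ι (3 * m)) σ' (y (3 * m)))) ∧
      (∀ m : ℕ, Squarefree m →
        (∀ q ∈ m.primeFactors, ¬ q ∣ N ∧ (Ideal.span {(q : 𝓞 K)}).IsPrime) →
        ∀ (ℓ : ℕ) (_ : ℓ ∈ m.primeFactors)
          (hle : ringClassField K ι (3 * (m / ℓ)) ≤ ringClassField K ι (3 * m))
          (σ : ringClassField K ι (3 * m) ≃ₐ[ℚ] ringClassField K ι (3 * m)),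
          Subgroup.zpowers σ = ringClassGalOver ι (3 * m) (3 * (m / ℓ)) →
          letI : Algebra K ℂ := ι.toAlgebra
          ∑ i ∈ Finset.range (ℓ + 1), pointGalHom W (ringClassField K ι (3 * m)) (σ ^ i) (y (3 * m)) =
            W.frobeniusTrace ℓ • WeierstrassCurve.Affine.Point.map (W' := W)
              ((RingClassField.inclusion ι hle).restrictScalars ℚ) (y (3 * (m / ℓ)))) ∧
      (∀ m : ℕ, Squarefree m →
        (∀ q ∈ m.primeFactors, ¬ q ∣ N ∧ (Ideal.span {(q : 𝓞 K)}).IsPrime) →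
        ∀ (ℓ : ℕ) (_ : ℓ ∈ m.primeFactors) [Fact ℓ.Prime] (hΔ : ¬ (ℓ : ℤ) ∣ minimalDiscriminantInt W)
          (φ₀ : absoluteGaloisGroup (ZMod ℓ)), (∀ x : AlgebraicClosure (ZMod ℓ), φ₀ • x = x ^ ℓ) →
        ∀ (hle : ringClassField K ι (3 * (m / ℓ)) ≤ ringClassField K ι (3 * m))
          (emb : ringClassField K ι (3 * m) →+* AlgebraicClosure K),
          (∀ x : K, emb (algebraMap K (ringClassField K ι (3 * m)) x) = algebraMap K (AlgebraicClosure K) x) →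
        ∀ (j : (W.baseChange (ringClassField K ι (3 * m))).toAffine.Point →+ geomPoints (W.baseChange K)),
          j = WeierstrassCurve.Affine.Point.map (W' := W) emb.toRatAlgHom →
        ∀ γ : ringClassField K ι (3 * m) ≃ₐ[ℚ] ringClassField K ι (3 * m), γ ∈ ringClassGal ι (3 * m) →
          letI : Algebra K ℂ := ι.toAlgebra
          geomReduction hΔ ((RatClosure.pointsEquiv (K := K) W).symm
              (j (pointGalHom W (ringClassField K ι (3 * m)) γ (y (3 * m))))) =
            φ₀ • geomReduction hΔ ((RatClosure.pointsEquiv (K := K) W).symm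
              (j (pointGalHom W (ringClassField K ι (3 * m)) γ
                (WeierstrassCurve.Affine.Point.map (W' := W)
                  ((RingClassField.inclusion ι hle).restrictScalars ℚ) (y (3 * (m / ℓ))))))))

end Fact

end Literature.NumberTheory.EllipticCurves

end
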